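import Mathlib
import Summits.Ventures.PercRepro2.Graph
import Summits.Ventures.PercRepro2.Exploration
import Summits.Ventures.PercRepro2.Harris
import Summits.Ventures.PercRepro2.GibbsPAJoint
import Summits.Ventures.PercRepro2.SepClusterJoint
import Summits.Ventures.PercRepro2.SepClusterSupport
import Summits.Ventures.PercRepro2.SepClusterHarris
import Summits.Ventures.PercRepro2.SepClusterPA

/-!
# Negative association across the separation — single-root form (blind cell PercRepro2, p3 g12,
2026-08-27; `proofs/P3-G2.md` Theorem B with `X = {x}`, `Y = {y}`, and the corollary (G2))

Conditioned on `{x ↮ y}`, a monotone function of `C(x)` and a monotone function of `C(y)` are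
NEGATIVELY correlated:
  `P(S) · E[1_S · f(C(x)) g(C(y))] ≤ E[1_S · f(C(x))] · E[1_S · g(C(y))]`
(`sep_cluster_cross`).  One line from Theorem A (`cov_nonneg_incY`): the conditional expectation
`D ↦ E[f(C(x)) | C(y) = D] = E[f(C_{G − D}(x))]` is ANTITONE in `D` on the support
(`incY_neg_condS_transpose`), so its covariance with the monotone `g` is `≤ 0`.  Corollary
(`sep_conn_cross`, the single-root (G2) of `P3-M9.md` §5): for vertices `u, v`,
`P(x ↔ u, y ↔ v, S) · P(S) ≤ P(x ↔ u, S) · P(y ↔ v, S)`.  Edge weights strictly inside `(0, 1)`.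
Own work; standard axioms.
-/

namespace Summit.Ventures.PercRepro2

namespace SepPA

open Finset Classical

section Separated

variable {V : Type*} {E : Type*} [Fintype V] [Fintype E] [DecidableEq E]
variable (ends : E → Sym2 V) (p : E → ℝ) (x y : V)

/-- Functions of the `x`-cluster monotone on the support of the `x`-marginal. -/
def IncX (f : Set V → ℝ) : Prop :=
  ∀ K K' : Set V, (∑ D, J ends p x y D K) ≠ 0 → (∑ D, J ends p x y D K') ≠ 0 → K ⊆ K' →
    f K ≤ f K'

variable {x y}

/-- Monotone functions of sets are monotone on the `x`-support. -/
lemma incX_of_monotone {f : Set V → ℝ} (hf : Monotone f) : IncX ends p x y f :=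
  fun _ _ _ _ h => hf h

/-- The conditional expectation of an `IncX` function given the `y`-cluster is antitone on the
support: its negative is `IncY`. -/
theorem incY_neg_condS_transpose (hp01 : ∀ e, 0 < p e ∧ p e < 1) (hxy : x ≠ y)
    {f : Set V → ℝ} (hf : IncX ends p x y f) :
    IncY ends p x y
      (fun D => -(GibbsPAJoint.condS (GibbsPAJoint.transpose (J ends p x y)) f D)) := by
  intro D D' hD hD' hDD'
  simp only
  rw [condS_transpose_eq_expect ends p hp01 hxy f hD,
    condS_transpose_eq_expect ends p hp01 hxy f hD']
  have : expect p (fun ω => f (clAway ends D' x ω)) ≤ expect p (fun ω => f (clAway ends D x ω)) := by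
    apply expect_mono (isProbVec_of_interior p hp01)
    intro ω
    exact hf _ _ (clAway_mem_support_left ends p hp01 hxy hD' ω)
      (clAway_mem_support_left ends p hp01 hxy hD ω) (clAway_anti ends hDD' x ω)
  linarith

/-- The expectation of `1_S · f(C(x))` through the `x`-marginal. -/
lemma expect_indicator_cluster_x (hp01 : ∀ e, 0 < p e ∧ p e < 1) (hxy : x ≠ y)
    (f : Set V → ℝ) :
    expect p (fun ω => (sepEvent ends x y).indicator (fun _ => (1 : ℝ)) ω * f (cluster ends ω x))
      = prob p (sepEvent ends x y) * ∑ K, (∑ D, J ends p x y D K) * f K := by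
  have hS : prob p (sepEvent ends x y) ≠ 0 := ne_of_gt (prob_sepEvent_pos ends p hp01 hxy)
  rw [expect_indicator_comp_eq_sum p (sepEvent ends x y) (fun ω => cluster ends ω x) f,
    Finset.mul_sum]
  apply Finset.sum_congr rfl
  intro K _
  rw [sum_J_left]
  have : sepEvent ends x y ∩ {ω | cluster ends ω x = K} =
      clusterEvent ends x K ∩ sepEvent ends x y := by
    rw [Set.inter_comm]; rfl
  rw [this]
  field_simp

/-- The expectation of `1_S · f(C(x)) g(C(y))` through the joint law. -/
lemma expect_indicator_cluster_xy (hp01 : ∀ e, 0 < p e ∧ p e < 1) (hxy : x ≠ y)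
    (f g : Set V → ℝ) :
    expect p (fun ω => (sepEvent ends x y).indicator (fun _ => (1 : ℝ)) ω *
        (f (cluster ends ω x) * g (cluster ends ω y)))
      = prob p (sepEvent ends x y) * ∑ D, ∑ K, J ends p x y D K * (f K * g D) := by
  have hS : prob p (sepEvent ends x y) ≠ 0 := ne_of_gt (prob_sepEvent_pos ends p hp01 hxy)
  have h := expect_indicator_comp_eq_sum p (sepEvent ends x y)
    (fun ω => (cluster ends ω y, cluster ends ω x)) (fun DK => f DK.2 * g DK.1)
  simp only at h
  rw [h, Fintype.sum_prod_type, Finset.mul_sum]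
  apply Finset.sum_congr rfl
  intro D _
  rw [Finset.mul_sum]
  apply Finset.sum_congr rfl
  intro K _
  unfold J
  have : sepEvent ends x y ∩ {ω | (cluster ends ω y, cluster ends ω x) = (D, K)} =
      clusterEvent ends y D ∩ clusterEvent ends x K ∩ sepEvent ends x y := by
    ext ω
    simp only [Set.mem_inter_iff, Set.mem_setOf_eq, Prod.mk.injEq, mem_clusterEvent]
    tauto
  rw [this]
  field_simp

/-- **Negative association across the separation (single-root form, Theorem B of `P3-G2.md`).**
For edge weights in `(0,1)`, `x ≠ y`, monotone `f` (of `C(x)`) and monotone `g` (of `C(y)`):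
`P(S) · E[1_S f(C(x)) g(C(y))] ≤ E[1_S f(C(x))] · E[1_S g(C(y))]`, `S = {x ↮ y}`. -/
theorem sep_cluster_cross (hp01 : ∀ e, 0 < p e ∧ p e < 1) (hxy : x ≠ y) (f g : Set V → ℝ)
    (hf : Monotone f) (hg : Monotone g) :
    prob p (sepEvent ends x y) *
      expect p (fun ω => (sepEvent ends x y).indicator (fun _ => (1 : ℝ)) ω *
        (f (cluster ends ω x) * g (cluster ends ω y))) ≤
    expect p (fun ω => (sepEvent ends x y).indicator (fun _ => (1 : ℝ)) ω *
        f (cluster ends ω x)) *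
      expect p (fun ω => (sepEvent ends x y).indicator (fun _ => (1 : ℝ)) ω *
        g (cluster ends ω y)) := by
  have hJ0 : ∀ D K, 0 ≤ J ends p x y D K := J_nonneg ends p hp01
  have hJ0' : ∀ K D, 0 ≤ GibbsPAJoint.transpose (J ends p x y) K D := fun K D => hJ0 D K
  set A := GibbsPAJoint.condS (GibbsPAJoint.transpose (J ends p x y)) f with hA
  -- the joint expectation through the conditional expectation `A`
  have hjoint : ∑ D, ∑ K, J ends p x y D K * (f K * g D) =
      ∑ D, (∑ K, J ends p x y D K) * (g D * A D) := by
    apply Finset.sum_congr rfl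
    intro D _
    have m := GibbsPAJoint.marg_mul_condS (GibbsPAJoint.transpose (J ends p x y)) hJ0' f D
    simp only [GibbsPAJoint.transpose] at m
    rw [hA]
    calc ∑ K, J ends p x y D K * (f K * g D) = g D * ∑ K, J ends p x y D K * f K := by
          rw [Finset.mul_sum]; apply Finset.sum_congr rfl; intro K _; ring
      _ = g D * ((∑ K, J ends p x y D K) *
          GibbsPAJoint.condS (GibbsPAJoint.transpose (J ends p x y)) f D) := by rw [m]
      _ = _ := by ring
  -- the tower property: `∑ D, q D · A D = ∑ K, Q K · f K`
  have htower : ∑ D, (∑ K, J ends p x y D K) * A D = ∑ K, (∑ D, J ends p x y D K) * f K := by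
    have := GibbsPAJoint.sum_marg_condS (GibbsPAJoint.transpose (J ends p x y)) hJ0' f
    simp only [GibbsPAJoint.transpose] at this
    rw [hA]
    exact this
  -- Theorem A for `g` and `−A`
  have hcov := cov_nonneg_incY ends p hp01 hxy g (fun D => -A D) (incY_of_monotone ends p hg)
    (incY_neg_condS_transpose ends p hp01 hxy (incX_of_monotone ends p hf))
  unfold GibbsPAq.cov at hcov
  simp only [mul_neg, Finset.sum_neg_distrib] at hcov
  -- assemble
  rw [expect_indicator_cluster_xy ends p hp01 hxy f g, expect_indicator_cluster_x ends p hp01 hxy f,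
    expect_indicator_cluster ends p hp01 hxy g, hjoint, ← htower]
  have hS0 : 0 ≤ prob p (sepEvent ends x y) := le_of_lt (prob_sepEvent_pos ends p hp01 hxy)
  have key : ∑ D, (∑ K, J ends p x y D K) * (g D * A D) ≤
      (∑ D, (∑ K, J ends p x y D K) * g D) * ∑ D, (∑ K, J ends p x y D K) * A D := by
    linarith
  have := mul_le_mul_of_nonneg_left key (mul_nonneg hS0 hS0)
  nlinarith [this]

/-- The single-root (G2): `P(x ↔ u, y ↔ v, S) · P(S) ≤ P(x ↔ u, S) · P(y ↔ v, S)`. -/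
theorem sep_conn_cross (hp01 : ∀ e, 0 < p e ∧ p e < 1) (hxy : x ≠ y) (u v : V) :
    prob p (sepEvent ends x y) *
      prob p (sepEvent ends x y ∩ (connEvent ends x u ∩ connEvent ends y v)) ≤
    prob p (sepEvent ends x y ∩ connEvent ends x u) *
      prob p (sepEvent ends x y ∩ connEvent ends y v) := by
  have hf : Monotone (fun K : Set V => if u ∈ K then (1 : ℝ) else 0) := by
    intro K K' h
    by_cases hu : u ∈ K
    · simp [hu, h hu]
    · simp [hu]
      split_ifs <;> norm_num
  have hg : Monotone (fun D : Set V => if v ∈ D then (1 : ℝ) else 0) := by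
    intro D D' h
    by_cases hv : v ∈ D
    · simp [hv, h hv]
    · simp [hv]
      split_ifs <;> norm_num
  have H := sep_cluster_cross ends p hp01 hxy _ _ hf hg
  -- the three expectations are the three probabilities
  have e1 : expect p (fun ω => (sepEvent ends x y).indicator (fun _ => (1 : ℝ)) ω *
      ((if u ∈ cluster ends ω x then (1 : ℝ) else 0) *
        (if v ∈ cluster ends ω y then (1 : ℝ) else 0))) =
      prob p (sepEvent ends x y ∩ (connEvent ends x u ∩ connEvent ends y v)) := by
    rw [prob_eq_expect_indicator]
    unfold expect
    apply Finset.sum_congr rfl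
    intro ω _
    congr 1
    by_cases hS : ω ∈ sepEvent ends x y <;> by_cases hu : Conn ends ω x u <;>
      by_cases hv : Conn ends ω y v <;>
      simp [Set.mem_inter_iff, mem_connEvent, mem_cluster, hS, hu, hv]
  have e2 : expect p (fun ω => (sepEvent ends x y).indicator (fun _ => (1 : ℝ)) ω *
      (if u ∈ cluster ends ω x then (1 : ℝ) else 0)) =
      prob p (sepEvent ends x y ∩ connEvent ends x u) := by
    rw [prob_eq_expect_indicator]
    unfold expect
    apply Finset.sum_congr rfl
    intro ω _
    congr 1
    by_cases hS : ω ∈ sepEvent ends x y <;> by_cases hu : Conn ends ω x u <;>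
      simp [Set.mem_inter_iff, mem_connEvent, mem_cluster, hS, hu]
  have e3 : expect p (fun ω => (sepEvent ends x y).indicator (fun _ => (1 : ℝ)) ω *
      (if v ∈ cluster ends ω y then (1 : ℝ) else 0)) =
      prob p (sepEvent ends x y ∩ connEvent ends y v) := by
    rw [prob_eq_expect_indicator]
    unfold expect
    apply Finset.sum_congr rfl
    intro ω _
    congr 1
    by_cases hS : ω ∈ sepEvent ends x y <;> by_cases hv : Conn ends ω y v <;>
      simp [Set.mem_inter_iff, mem_connEvent, mem_cluster, hS, hv]
  rw [e1, e2, e3] at H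
  exact H

end Separated

end SepPA

end Summit.Ventures.PercRepro2
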